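import Literature.MathematicalPhysics.QuantumLattice.KroneckerPartialTrace
import HarnessLib

/-!
# The MPS coarse-graining maps of the Kull–Schuch–Dive–Navascués relaxation: words `A^{t₁}⋯A^{t_k}`, the maps
# `W_k`, `L`, `R`, the extension identities `W_{k+1} = L ∘ (𝟙 ⊗ W_k) = R ∘ (W_k ⊗ 𝟙)`, the compressed window
# variables `ω = (𝟙 ⊗ W_k ⊗ 𝟙) ρ (𝟙 ⊗ W_k ⊗ 𝟙)ᴴ`, and the relaxation rows evaluated on true window marginals

Family `hubbard` (topic `MathematicalPhysics/QuantumLattice`; Part 3 of the partial-trace API begun in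
`SpinPartialTrace` / `KroneckerPartialTrace`, serving the sr-mbsolver lane-B transport "theorem B" = soundness of the
`relax = mps(n, D, A)` rows of the coarse-grained locally-translation-invariant (LTI) relaxation).

Kull–Schuch–Dive–Navascués relax the LTI hierarchy `ρ^{(2)} ← ρ^{(3)} ← ⋯ ← ρ^{(n)}` of window marginals of a
translation-invariant chain state (`ρ^{(m-1)} = tr_L ρ^{(m)} = tr_R ρ^{(m)}`) by COMPRESSING each window with a
uniform matrix-product-state tensor `A = (A^s)_{s}` (`A^s` a `D × D` matrix for each site state `s`): the map
`W_k : (ℂ^d)^{⊗k} → ℂ^D ⊗ ℂ^D`, `(W_k)_{(a,b),(t₁,…,t_k)} = (A^{t₁} A^{t₂} ⋯ A^{t_k})_{ab}` ("contracting `k` copies of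
the tensor along the bonds results in a map from `k` spins to the bonds at the edges", §2.5), is applied to the
middle `k = m-2` sites of the `m`-site window, `ω_m := (𝟙 ⊗ W_{m-2} ⊗ 𝟙) ρ^{(m)} (𝟙 ⊗ W_{m-2} ⊗ 𝟙)ᴴ` (§2.3,
`C(ρ) = (𝟙 ⊗ W ⊗ 𝟙) ρ (𝟙 ⊗ W† ⊗ 𝟙)`), and because "contracting `m+1` copies of `A` can be done in either order"
(§4.2 eq. (MPSextension)) there are one-step maps `L : ℂ^d ⊗ (ℂ^D ⊗ ℂ^D) → ℂ^D ⊗ ℂ^D`,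
`L_{(a,b),(t,(c,b'))} = A^t_{ac} δ_{bb'}`, and `R : (ℂ^D ⊗ ℂ^D) ⊗ ℂ^d → ℂ^D ⊗ ℂ^D`, `R_{(a,b),((a',c),t)} = δ_{aa'} A^t_{cb}`,
with
  `W_{k+1} = L ∘ (𝟙_d ⊗ W_k) = R ∘ (W_k ⊗ 𝟙_d)`                                   (§2.4 eq. (MPSrelationM)),
so that the marginal conditions turn into the rows of the relaxation (§2.5 eq. (TNfullRelax5), §4.2 eq. (relaxLocTIn)):
  `(W₂ ⊗ 𝟙) ρ^{(3)} (W₂ ⊗ 𝟙)ᴴ = tr_L ω₄`,  `(𝟙 ⊗ W₂) ρ^{(3)} (𝟙 ⊗ W₂)ᴴ = tr_R ω₄`,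
  `(L ⊗ 𝟙) ω_{m-1} (L ⊗ 𝟙)ᴴ = tr_L ω_m`,    `(𝟙 ⊗ R) ω_{m-1} (𝟙 ⊗ R)ᴴ = tr_R ω_m`      (`m ≥ 5`).
This file proves exactly this algebra, for an ARBITRARY tensor `A` (its quality affects tightness only, never
soundness) over arbitrary finite site and bond index types:

* `MPSCoarseGraining.word A t = A^{t₀} ⋯ A^{t_{k-1}}` with its two recursions (`word_cons`, `word_snoc`);
  `cgMap A k = W_k`, `leftMap A = L`, `rightMap A = R` (definitions with bodies, entry formulas by `rfl`);
* **the extension identities** `cgMap_succ_submatrix_consEquiv : W_{k+1} ∘ cons = L (𝟙 ⊗ₖ W_k)` and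
  `cgMap_succ_submatrix_snocEquiv : W_{k+1} ∘ snoc = R (W_k ⊗ₖ 𝟙)` (readings first × rest / rest × last of a configuration);
* the compressed window variable `cgState A k ρ = (𝟙 ⊗ₖ (W_k ⊗ₖ 𝟙)) ρ̃ (…)ᴴ` of a `(k+2)`-site window operator `ρ`
  (`ρ̃` = `ρ` in the three-leg coordinates `windowSplit3` of `KroneckerPartialTrace`), positive semidefinite with `ρ`;
* **the substitution identities** (§2.4 eq. (TNrho5constraintsSUB)): `(W_{k+1} ⊗ 𝟙) Y (W_{k+1} ⊗ 𝟙)ᴴ =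
  (L ⊗ 𝟙) · cgState A k Y · (L ⊗ 𝟙)ᴴ` and `(𝟙 ⊗ W_{k+1}) Y (𝟙 ⊗ W_{k+1})ᴴ = (𝟙 ⊗ R) · cgState A k Y · (𝟙 ⊗ R)ᴴ`
  for every `(k+2)`-window operator `Y` (up to the bookkeeping reassociations, all explicit);
* **the rows on true marginals**: for every `(k+2)`-window operator `ρ`,
  `tr_L (cgState A k ρ) = (W_k ⊗ 𝟙) (tr_L ρ) (W_k ⊗ 𝟙)ᴴ` and `tr_R (cgState A k ρ) = (𝟙 ⊗ W_k) (tr_R ρ) (𝟙 ⊗ W_k)ᴴ`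
  (`traceLeft_cgState`, `traceRight_cgState_submatrix_prodAssoc`; at `k = 2` these are the rows `E4L`/`E4R`), and for
  every `(k+3)`-window operator `ρ`, `tr_L (cgState A (k+1) ρ) = (L ⊗ 𝟙) cgState A k (tr_L ρ) (L ⊗ 𝟙)ᴴ`,
  `tr_R (cgState A (k+1) ρ) = (𝟙 ⊗ R) cgState A k (tr_R ρ) (𝟙 ⊗ R)ᴴ` (`traceLeft_cgState_succ`,
  `traceRight_cgState_succ_submatrix_prodAssoc`; the rows `E_mL`/`E_mR`). Feeding in a consistent chain of marginals
  `tr_L ρ^{(m)} = ρ^{(m-1)} = tr_R ρ^{(m)}` gives KSDN's feasible point `(ρ^{(3)}, ω₄, …, ω_n)` of the relaxation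
  (§4.2: "these satisfy (arrowDiagram) due to (MPSextension) and the conditions `ρ_{1..m} = ρ_{2..m+1}`").
Everything is PROVED (no named facts); the definitions are the published objects `word`/`W_k`/`L`/`R` and the
compressed variable, each with a body. Index conventions = the sr-mbsolver lane-B generator's (`FORMAT-ltisdp.md` §1:
`(W₂)_{(a,b),(t₁,t₂)} = (A^{t₁}A^{t₂})_{ab}`, `L_{(a,b),(t,(c,b'))} = A^t_{ac}δ_{bb'}`, `R_{(a,b),((a',c),t)} = δ_{aa'}A^t_{cb}`,
`ω_m` indexed by `(s_L,(a,b),s_R)`), which are KSDN's.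

## References
* I. Kull, N. Schuch, B. Dive, M. Navascués, *Lower bounding ground-state energies of local Hamiltonians through the
  renormalization group*, Phys. Rev. X 14, 021008 (2024) = arXiv:2212.03014: §2.3 (`C_2(ρ^{(4)}) = (𝟙 ⊗ W₂ ⊗ 𝟙) ρ^{(4)} (…)†`),
  §2.4 (eqs. (MPSrelation), (TNrho5constraintsSUB), (MPSrelationM) `W_{m+1} = R_m ∘ (W_m ⊗ id) = L_m ∘ (id ⊗ W_m)`),
  §2.5 (MPS ansatz for `W_m`, eq. (TNfullRelax5)), §4.2 (eqs. (MPSextension), (relaxLocTIn)). [cite: KullEtAl2024, §2.3–2.5, §4.2]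

## Mathlib / tree
Used: `Matrix.kroneckerMap` / `⊗ₖ` (`mul_kronecker_mul`, `kroneckerMap_apply`), `Matrix.submatrix_mul_equiv`,
`Matrix.conjTranspose_submatrix`, `Fin.consEquiv` / `Fin.snocEquiv`, `List.ofFn_succ` / `List.ofFn_succ'`; tree:
KroneckerPartialTrace (`windowSplit3`, `traceLeft_middle_conj`, `traceRight_prodAssoc_middle_conj`,
`one_kronecker_kronecker_one_submatrix_prodAssoc`, `submatrix_windowSplit3_prodAssoc`, `submatrix_windowSplit3_eq`,
`spinPartialTrace_{succEmb,castSuccEmb}_submatrix_eq_trace{Left,Right}_windowSplit3`), QuantumMarginals (`traceLeft/Right`).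
-/

noncomputable section

namespace Literature.MathematicalPhysics.QuantumLattice

open Matrix Finset Literature.Computability.QuantumComplexity
open scoped ComplexOrder BigOperators Kronecker

namespace MPSCoarseGraining

/-! ### Words `A^{t₁} ⋯ A^{t_k}` of an MPS tensor -/

section Words

variable {σ β : Type*} [Fintype β] [DecidableEq β]

/-- The MPS word (transfer product) of a tensor `A = (A^s)_s` along a `k`-site configuration `t`:
`word A t = A^{t₀} A^{t₁} ⋯ A^{t_{k-1}}` ("contracting `k` copies of the tensor along the bonds").
[cite: KullEtAl2024, §2.5 (the maps `W_m`), §4.2 eq. (MPSextension)] -/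
def word (A : σ → Matrix β β ℂ) {k : ℕ} (t : Fin k → σ) : Matrix β β ℂ :=
  (List.ofFn fun i => A (t i)).prod

/-- The empty word is the identity on the bond space. [cite: KullEtAl2024, §2.5] -/
@[simp] theorem word_zero (A : σ → Matrix β β ℂ) (t : Fin 0 → σ) : word A t = 1 := by
  simp [word]

/-- First-site recursion: `A^{t₀} ⋯ A^{t_k} = A^{t₀} · (A^{t₁} ⋯ A^{t_k})`. [cite: KullEtAl2024, §4.2 eq. (MPSextension)] -/
theorem word_succ (A : σ → Matrix β β ℂ) {k : ℕ} (t : Fin (k + 1) → σ) :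
    word A t = A (t 0) * word A (Fin.tail t) := by
  simp only [word, List.ofFn_succ, List.prod_cons]
  rfl

/-- `word A (cons s t) = A^s · word A t` (one more tensor contracted from the LEFT).
[cite: KullEtAl2024, §4.2 eq. (MPSextension)] -/
theorem word_cons (A : σ → Matrix β β ℂ) {k : ℕ} (s : σ) (t : Fin k → σ) :
    word A (Fin.cons s t : Fin (k + 1) → σ) = A s * word A t := by
  rw [word_succ, Fin.cons_zero, Fin.tail_cons]

/-- Last-site recursion: `A^{t₀} ⋯ A^{t_k} = (A^{t₀} ⋯ A^{t_{k-1}}) · A^{t_k}`. [cite: KullEtAl2024, §4.2 eq. (MPSextension)] -/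
theorem word_succ' (A : σ → Matrix β β ℂ) {k : ℕ} (t : Fin (k + 1) → σ) :
    word A t = word A (Fin.init t) * A (t (Fin.last k)) := by
  simp only [word, List.ofFn_succ', List.concat_eq_append, List.prod_append, List.prod_cons, List.prod_nil, mul_one]
  rfl

/-- `word A (snoc t s) = word A t · A^s` (one more tensor contracted from the RIGHT).
[cite: KullEtAl2024, §4.2 eq. (MPSextension)] -/
theorem word_snoc (A : σ → Matrix β β ℂ) {k : ℕ} (t : Fin k → σ) (s : σ) :
    word A (Fin.snoc t s : Fin (k + 1) → σ) = word A t * A s := by rw [word_succ', Fin.init_snoc, Fin.snoc_last]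

/-- A one-letter word is the tensor itself. [cite: KullEtAl2024, §2.5] -/
theorem word_one (A : σ → Matrix β β ℂ) (t : Fin 1 → σ) : word A t = A (t 0) := by rw [word_succ, word_zero, mul_one]

/-- A two-letter word: `word A t = A^{t₀} A^{t₁}` (the entries of `W₂`). [cite: KullEtAl2024, §2.3 (`W_2`)] -/
theorem word_two (A : σ → Matrix β β ℂ) (t : Fin 2 → σ) : word A t = A (t 0) * A (t 1) := by
  rw [word_succ, word_one]; rfl

end Words

/-! ### The coarse-graining maps `W_k`, `L`, `R` and the extension identities -/

section Maps

variable {σ β : Type*} [DecidableEq β]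

/-- **The left one-step map `L : ℂ^d ⊗ (ℂ^D ⊗ ℂ^D) → ℂ^D ⊗ ℂ^D`**, `L_{(a,b),(t,(c,b'))} = A^t_{ac} δ_{bb'}`: contract one more
tensor from the left, identity on the right bond. [cite: KullEtAl2024, §2.4 (`L_2`), §4.2 (`l^{y}_{1,o} := (…) ⊗ id`)] -/
def leftMap (A : σ → Matrix β β ℂ) : Matrix (β × β) (σ × (β × β)) ℂ :=
  Matrix.of fun ab p => A p.1 ab.1 p.2.1 * if ab.2 = p.2.2 then 1 else 0

/-- Entries of `L`. [cite: KullEtAl2024, §2.4, §4.2] -/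
@[simp] theorem leftMap_apply (A : σ → Matrix β β ℂ) (ab : β × β) (p : σ × (β × β)) :
    leftMap A ab p = A p.1 ab.1 p.2.1 * if ab.2 = p.2.2 then 1 else 0 := rfl

/-- **The right one-step map `R : (ℂ^D ⊗ ℂ^D) ⊗ ℂ^d → ℂ^D ⊗ ℂ^D`**, `R_{(a,b),((a',c),t)} = δ_{aa'} A^t_{cb}`: contract one
more tensor from the right, identity on the left bond. [cite: KullEtAl2024, §2.4 (`R_2`), §4.2 (`r^{x}_{o,m+1} := id ⊗ (…)`)] -/
def rightMap (A : σ → Matrix β β ℂ) : Matrix (β × β) ((β × β) × σ) ℂ :=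
  Matrix.of fun ab p => (if ab.1 = p.1.1 then 1 else 0) * A p.2 p.1.2 ab.2

/-- Entries of `R`. [cite: KullEtAl2024, §2.4, §4.2] -/
@[simp] theorem rightMap_apply (A : σ → Matrix β β ℂ) (ab : β × β) (p : (β × β) × σ) :
    rightMap A ab p = (if ab.1 = p.1.1 then 1 else 0) * A p.2 p.1.2 ab.2 := rfl

variable [Fintype β]

/-- **KSDN's coarse-graining map `W_k : (ℂ^d)^{⊗k} → ℂ^D ⊗ ℂ^D`** built from the MPS tensor `A`:
`(W_k)_{(a,b),t} = (A^{t₀} ⋯ A^{t_{k-1}})_{ab}` — rows indexed by the pair of edge bonds `(a,b)`, columns by the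
`k`-site configurations `t`. [cite: KullEtAl2024, §2.5 (`W_m`, "the coarse-graining dimension χ equals D²"), §4.2 (`w^{o}_{1..m}`)] -/
def cgMap (A : σ → Matrix β β ℂ) (k : ℕ) : Matrix (β × β) (Fin k → σ) ℂ :=
  Matrix.of fun ab t => word A t ab.1 ab.2

/-- Entries of `W_k`. [cite: KullEtAl2024, §2.5] -/
@[simp] theorem cgMap_apply (A : σ → Matrix β β ℂ) (k : ℕ) (ab : β × β) (t : Fin k → σ) :
    cgMap A k ab t = word A t ab.1 ab.2 := rfl

/-- Entries of `W₂`: `(W₂)_{(a,b),(t₀,t₁)} = (A^{t₀} A^{t₁})_{ab}` (the lane-B generator's `W₂` verbatim).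
[cite: KullEtAl2024, §2.3 (`W_2 : ℂ^d ⊗ ℂ^d → ℂ^χ`)] -/
theorem cgMap_two_apply (A : σ → Matrix β β ℂ) (ab : β × β) (t : Fin 2 → σ) :
    cgMap A 2 ab t = (A (t 0) * A (t 1)) ab.1 ab.2 := by
  rw [cgMap_apply, word_two]

variable [Fintype σ] [DecidableEq σ]

/-- **Extension identity, left** (KSDN eq. (MPSrelationM) / (MPSextension), first form): reading a `(k+1)`-site
configuration as (first site, rest), `W_{k+1} = L ∘ (𝟙_d ⊗ W_k)`. [cite: KullEtAl2024, §2.4 eq. (MPSrelationM), §4.2 eq. (MPSextension)] -/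
theorem cgMap_succ_submatrix_consEquiv (A : σ → Matrix β β ℂ) (k : ℕ) :
    (cgMap A (k + 1)).submatrix id (Fin.consEquiv fun _ => σ) =
      leftMap A * ((1 : Matrix σ σ ℂ) ⊗ₖ cgMap A k) := by
  ext ⟨a, b⟩ ⟨s, t⟩
  have lhs : ((cgMap A (k + 1)).submatrix id ⇑(Fin.consEquiv fun _ => σ)) (a, b) (s, t) = (A s * word A t) a b := by
    rw [Matrix.submatrix_apply, id_eq, cgMap_apply, ← word_cons]
    rfl
  rw [lhs]
  symm
  rw [Matrix.mul_apply, Fintype.sum_prod_type, Fintype.sum_eq_single s]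
  · rw [Fintype.sum_prod_type, Matrix.mul_apply]
    refine Finset.sum_congr rfl fun c _ => ?_
    rw [Fintype.sum_eq_single b]
    · simp [Matrix.kroneckerMap_apply]
    · intro b' hb'
      simp [hb'.symm]
  · intro s' hs'
    refine Finset.sum_eq_zero fun cb _ => ?_
    simp [Matrix.kroneckerMap_apply, hs']

/-- **Extension identity, right** (KSDN eq. (MPSrelationM) / (MPSextension), second form): reading a `(k+1)`-site
configuration as (rest, last site), `W_{k+1} = R ∘ (W_k ⊗ 𝟙_d)`. [cite: KullEtAl2024, §2.4 eq. (MPSrelationM), §4.2 eq. (MPSextension)] -/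
theorem cgMap_succ_submatrix_snocEquiv (A : σ → Matrix β β ℂ) (k : ℕ) :
    (cgMap A (k + 1)).submatrix id ((Equiv.prodComm _ _).trans (Fin.snocEquiv fun _ => σ)) =
      rightMap A * (cgMap A k ⊗ₖ (1 : Matrix σ σ ℂ)) := by
  ext ⟨a, b⟩ ⟨t, s⟩
  have lhs : ((cgMap A (k + 1)).submatrix id ⇑((Equiv.prodComm _ _).trans (Fin.snocEquiv fun _ => σ))) (a, b) (t, s) =
      (word A t * A s) a b := by
    rw [Matrix.submatrix_apply, id_eq, cgMap_apply, ← word_snoc]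
    rfl
  rw [lhs]
  symm
  rw [Matrix.mul_apply, Fintype.sum_prod_type, Fintype.sum_prod_type, Fintype.sum_eq_single a]
  · rw [Matrix.mul_apply]
    refine Finset.sum_congr rfl fun c _ => ?_
    rw [Fintype.sum_eq_single s]
    · simp [Matrix.kroneckerMap_apply, mul_comm]
    · intro s' hs'
      simp [Matrix.kroneckerMap_apply, hs']
  · intro a' ha'
    refine Finset.sum_eq_zero fun c _ => Finset.sum_eq_zero fun s' _ => ?_
    simp [ha'.symm]

/-- Reindexing the column index of the left Kronecker factor along a map (bookkeeping, `rfl` entrywise). [folklore] -/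
private theorem submatrix_id_kronecker {l m m' n p : Type*} (M : Matrix l m ℂ) (e : m' ≃ m) (N : Matrix n p ℂ) :
    M.submatrix id e ⊗ₖ N = (M ⊗ₖ N).submatrix id (Equiv.prodCongr e (Equiv.refl p)) := by
  ext ⟨i, j⟩ ⟨x, y⟩
  rfl

/-- Reindexing the column index of the right Kronecker factor along a map (bookkeeping, `rfl` entrywise). [folklore] -/
private theorem kronecker_submatrix_id {l m n p p' : Type*} (M : Matrix l m ℂ) (N : Matrix n p ℂ) (e : p' ≃ p) :
    M ⊗ₖ N.submatrix id e = (M ⊗ₖ N).submatrix id (Equiv.prodCongr (Equiv.refl m) e) := by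
  ext ⟨i, j⟩ ⟨x, y⟩
  rfl

/-- A sandwich `K X Kᴴ` is unchanged when the contracted index is relabelled along an equivalence
(bookkeeping). [folklore] -/
private theorem submatrix_id_mul_mul_conjTranspose {l m m' : Type*} [Fintype m] [Fintype m'] (K : Matrix l m ℂ) (e : m' ≃ m)
    (X : Matrix m' m' ℂ) :
    K.submatrix id e * X * (K.submatrix id e)ᴴ = K * X.submatrix e.symm e.symm * Kᴴ := by
  ext i i'
  simp only [Matrix.mul_apply, Matrix.conjTranspose_apply, Matrix.submatrix_apply, id_eq]
  rw [← e.sum_comp]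
  refine Finset.sum_congr rfl fun y _ => ?_
  rw [← e.sum_comp]
  simp only [Equiv.symm_apply_apply]

/-- `(L M) ⊗ 𝟙 = (L ⊗ 𝟙)(M ⊗ 𝟙)` (Mathlib's `mul_kronecker_mul`, recorded in the form used below). [folklore] -/
private theorem mul_kronecker_one {l m n c : Type*} [Fintype m] [Fintype c] [DecidableEq c] (L : Matrix l m ℂ) (M : Matrix m n ℂ) :
    (L * M) ⊗ₖ (1 : Matrix c c ℂ) = L ⊗ₖ (1 : Matrix c c ℂ) * M ⊗ₖ (1 : Matrix c c ℂ) := by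
  rw [← Matrix.mul_kronecker_mul, Matrix.mul_one]

/-- `𝟙 ⊗ (L M) = (𝟙 ⊗ L)(𝟙 ⊗ M)`. [folklore] -/
private theorem one_kronecker_mul {l m n c : Type*} [Fintype m] [Fintype c] [DecidableEq c] (L : Matrix l m ℂ) (M : Matrix m n ℂ) :
    (1 : Matrix c c ℂ) ⊗ₖ (L * M) = (1 : Matrix c c ℂ) ⊗ₖ L * (1 : Matrix c c ℂ) ⊗ₖ M := by
  rw [← Matrix.mul_kronecker_mul, Matrix.mul_one]

end Maps

/-! ### The compressed window variable `ω = (𝟙 ⊗ W_k ⊗ 𝟙) ρ (𝟙 ⊗ W_k ⊗ 𝟙)ᴴ` and the relaxation rows on true marginals -/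

section Windows

variable {β : Type*} [Fintype β] [DecidableEq β] {q : ℕ}

/-- **KSDN's compressed variable** `ω_{1,o,k+2} = C_k(ρ) := (𝟙 ⊗ W_k ⊗ 𝟙) ρ (𝟙 ⊗ W_k ⊗ 𝟙)ᴴ` of a `(k+2)`-site window
operator `ρ`: the middle `k` sites are coarse-grained by `W_k`, the two edge sites kept; indexed by
`(s_L, (a,b), s_R) ∈ [d] × ([D] × [D]) × [d]` (the window is first read in the three-leg coordinates `windowSplit3`).
[cite: KullEtAl2024, §2.3 (`C_2(ρ^{(4)}) = (𝟙 ⊗ W_2 ⊗ 𝟙) ρ^{(4)} (𝟙 ⊗ W_2† ⊗ 𝟙)`, `ω^{(4)}`), §2.5 (`C_{m-2}(ρ^{(m)}) ↪ ω^{(m)}`)] -/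
def cgState (A : Fin q → Matrix β β ℂ) (k : ℕ) (ρ : Op (Fin (k + 2)) q) :
    Matrix (Fin q × ((β × β) × Fin q)) (Fin q × ((β × β) × Fin q)) ℂ :=
  (1 : Matrix (Fin q) (Fin q) ℂ) ⊗ₖ (cgMap A k ⊗ₖ (1 : Matrix (Fin q) (Fin q) ℂ)) *
      ρ.submatrix (windowSplit3 k q) (windowSplit3 k q) *
    ((1 : Matrix (Fin q) (Fin q) ℂ) ⊗ₖ (cgMap A k ⊗ₖ (1 : Matrix (Fin q) (Fin q) ℂ)))ᴴ

/-- Unfolding `cgState`. [cite: KullEtAl2024, §2.3] -/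
theorem cgState_eq (A : Fin q → Matrix β β ℂ) (k : ℕ) (ρ : Op (Fin (k + 2)) q) :
    cgState A k ρ = (1 : Matrix (Fin q) (Fin q) ℂ) ⊗ₖ (cgMap A k ⊗ₖ (1 : Matrix (Fin q) (Fin q) ℂ)) *
      ρ.submatrix (windowSplit3 k q) (windowSplit3 k q) *
      ((1 : Matrix (Fin q) (Fin q) ℂ) ⊗ₖ (cgMap A k ⊗ₖ (1 : Matrix (Fin q) (Fin q) ℂ)))ᴴ := rfl

/-- Coarse-graining is completely positive: `ρ ⪰ 0 → C_k(ρ) ⪰ 0` (so the compressed variables of true marginals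
satisfy the positivity constraints `ω_m ≥ 0` of the relaxation). [cite: KullEtAl2024, §2.5 ("in addition demanding
`ω^{(m)} ≥ 0`"), §3.2] -/
theorem posSemidef_cgState (A : Fin q → Matrix β β ℂ) (k : ℕ) {ρ : Op (Fin (k + 2)) q} (hρ : ρ.PosSemidef) :
    (cgState A k ρ).PosSemidef :=
  posSemidef_kronecker_mul_mul_conjTranspose _ _ ((posSemidef_submatrix_windowSplit3_iff ρ).2 hρ)

/-- `C_k` is additive. [cite: KullEtAl2024, §3.2 (coarse-graining maps act on ensembles element-wise, linearly)] -/
theorem cgState_add (A : Fin q → Matrix β β ℂ) (k : ℕ) (ρ ρ' : Op (Fin (k + 2)) q) :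
    cgState A k (ρ + ρ') = cgState A k ρ + cgState A k ρ' := by
  simp only [cgState_eq, Matrix.submatrix_add, Pi.add_apply, Matrix.mul_add, Matrix.add_mul]

/-- `C_k` is homogeneous. [cite: KullEtAl2024, §3.2] -/
theorem cgState_smul (A : Fin q → Matrix β β ℂ) (k : ℕ) (c : ℂ) (ρ : Op (Fin (k + 2)) q) :
    cgState A k (c • ρ) = c • cgState A k ρ := by
  simp only [cgState_eq, Matrix.submatrix_smul, Pi.smul_apply, Matrix.mul_smul, Matrix.smul_mul]

/-! #### The rows `E4L` / `E4R`: tracing an edge site of `C_k(ρ)` -/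

/-- **Tracing out the LEFT edge site of the compressed window** (KSDN §2.3, the first row of eq. (TNoneStepRelaxation);
at `k = 2` this is the row `(W₂ ⊗ 𝟙) ρ^{(3)} (W₂ ⊗ 𝟙)ᴴ = tr_L ω₄` of eq. (relaxLocTIn) once `tr_L ρ^{(4)} = ρ^{(3)}`):
`tr_L C_k(ρ) = (W_k ⊗ 𝟙) · tr_L ρ · (W_k ⊗ 𝟙)ᴴ`, with `tr_L ρ = spinPartialTrace (Fin.succEmb (k+1)) ρ` read in the
coordinates (first `k` sites, last site). [cite: KullEtAl2024, §2.3 eq. (TNoneStepRelaxation), §4.2 eq. (relaxLocTIn)] -/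
theorem traceLeft_cgState (A : Fin q → Matrix β β ℂ) (k : ℕ) (ρ : Op (Fin (k + 2)) q) :
    traceLeft (cgState A k ρ) =
      (cgMap A k ⊗ₖ (1 : Matrix (Fin q) (Fin q) ℂ)) *
        (spinPartialTrace (Fin.succEmb (k + 1)) ρ).submatrix ((Equiv.prodComm _ _).trans (Fin.snocEquiv fun _ => Fin q))
          ((Equiv.prodComm _ _).trans (Fin.snocEquiv fun _ => Fin q)) *
      (cgMap A k ⊗ₖ (1 : Matrix (Fin q) (Fin q) ℂ))ᴴ := by
  rw [cgState_eq, traceLeft_middle_conj, ← spinPartialTrace_succEmb_submatrix_eq_traceLeft_windowSplit3]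

/-- **Tracing out the RIGHT edge site of the compressed window** (KSDN §2.3, the second row of eq. (TNoneStepRelaxation);
at `k = 2` the row `(𝟙 ⊗ W₂) ρ^{(3)} (𝟙 ⊗ W₂)ᴴ = tr_R ω₄`): `tr_R C_k(ρ) = (𝟙 ⊗ W_k) · tr_R ρ · (𝟙 ⊗ W_k)ᴴ`, with
`tr_R ρ = spinPartialTrace Fin.castSuccEmb ρ` read in the coordinates (first site, last `k` sites) and `tr_R` of the
compressed window taken after reassociating to `(s_L, (a,b)) × s_R`. [cite: KullEtAl2024, §2.3 eq. (TNoneStepRelaxation), §4.2 eq. (relaxLocTIn)] -/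
theorem traceRight_cgState_submatrix_prodAssoc (A : Fin q → Matrix β β ℂ) (k : ℕ) (ρ : Op (Fin (k + 2)) q) :
    traceRight ((cgState A k ρ).submatrix (Equiv.prodAssoc _ _ _) (Equiv.prodAssoc _ _ _)) =
      ((1 : Matrix (Fin q) (Fin q) ℂ) ⊗ₖ cgMap A k) *
        (spinPartialTrace Fin.castSuccEmb ρ).submatrix (Fin.consEquiv fun _ => Fin q) (Fin.consEquiv fun _ => Fin q) *
      ((1 : Matrix (Fin q) (Fin q) ℂ) ⊗ₖ cgMap A k)ᴴ := by
  rw [cgState_eq, traceRight_prodAssoc_middle_conj, ← spinPartialTrace_castSuccEmb_submatrix_eq_traceRight_windowSplit3]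

/-! #### The substitution identities: `W_{k+1} ⊗ 𝟙` and `𝟙 ⊗ W_{k+1}` through `L`, `R` and `C_k` -/

/-- **Substitution identity, left** (KSDN eq. (TNrho5constraintsSUB), first row): for every `(k+2)`-window operator `Y`,
read in the coordinates (first `k+1` sites, last site),
`(W_{k+1} ⊗ 𝟙) Y (W_{k+1} ⊗ 𝟙)ᴴ = (L ⊗ 𝟙) · C_k(Y) · (L ⊗ 𝟙)ᴴ` (with `C_k(Y)` reassociated to `(s_L,(a,b)) × s_R`).
This is how the marginal condition at level `k+3` is expressed through the compressed variable of level `k+2`.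
[cite: KullEtAl2024, §2.4 eqs. (MPSrelation), (TNrho5constraintsSUB)] -/
theorem cgMap_succ_kronecker_one_conj (A : Fin q → Matrix β β ℂ) (k : ℕ) (Y : Op (Fin (k + 2)) q) :
    (cgMap A (k + 1) ⊗ₖ (1 : Matrix (Fin q) (Fin q) ℂ)) *
        Y.submatrix ((Equiv.prodComm _ _).trans (Fin.snocEquiv fun _ => Fin q))
          ((Equiv.prodComm _ _).trans (Fin.snocEquiv fun _ => Fin q)) *
      (cgMap A (k + 1) ⊗ₖ (1 : Matrix (Fin q) (Fin q) ℂ))ᴴ =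
    (leftMap A ⊗ₖ (1 : Matrix (Fin q) (Fin q) ℂ)) *
        (cgState A k Y).submatrix (Equiv.prodAssoc _ _ _) (Equiv.prodAssoc _ _ _) *
      (leftMap A ⊗ₖ (1 : Matrix (Fin q) (Fin q) ℂ))ᴴ := by
  -- `W_{k+1} = (L (𝟙 ⊗ W_k)) ∘ cons⁻¹`
  have h1 : cgMap A (k + 1) =
      (leftMap A * ((1 : Matrix (Fin q) (Fin q) ℂ) ⊗ₖ cgMap A k)).submatrix id (Fin.consEquiv fun _ => Fin q).symm := by
    rw [← cgMap_succ_submatrix_consEquiv, Matrix.submatrix_submatrix, Function.comp_id, Equiv.self_comp_symm,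
      Matrix.submatrix_id_id]
  -- hence `W_{k+1} ⊗ 𝟙 = ((L ⊗ 𝟙) ((𝟙 ⊗ W_k) ⊗ 𝟙)) ∘ (cons⁻¹ × id)`
  have h2 : cgMap A (k + 1) ⊗ₖ (1 : Matrix (Fin q) (Fin q) ℂ) =
      ((leftMap A ⊗ₖ (1 : Matrix (Fin q) (Fin q) ℂ)) *
          ((((1 : Matrix (Fin q) (Fin q) ℂ) ⊗ₖ cgMap A k) ⊗ₖ (1 : Matrix (Fin q) (Fin q) ℂ)))).submatrix id
        (Equiv.prodCongr (Fin.consEquiv fun _ => Fin q).symm (Equiv.refl (Fin q))) := by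
    rw [h1, submatrix_id_kronecker, mul_kronecker_one]
  -- the inner sandwich is `C_k(Y)` reassociated
  have hinner : (cgState A k Y).submatrix (Equiv.prodAssoc (Fin q) (β × β) (Fin q)) (Equiv.prodAssoc (Fin q) (β × β) (Fin q)) =
      (((1 : Matrix (Fin q) (Fin q) ℂ) ⊗ₖ cgMap A k) ⊗ₖ (1 : Matrix (Fin q) (Fin q) ℂ)) *
        (Y.submatrix (windowSplit3 k q) (windowSplit3 k q)).submatrix (Equiv.prodAssoc _ _ _) (Equiv.prodAssoc _ _ _) *
      ((((1 : Matrix (Fin q) (Fin q) ℂ) ⊗ₖ cgMap A k) ⊗ₖ (1 : Matrix (Fin q) (Fin q) ℂ)))ᴴ := by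
    rw [cgState_eq, ← one_kronecker_kronecker_one_submatrix_prodAssoc, Matrix.conjTranspose_submatrix,
      Matrix.submatrix_mul_equiv, Matrix.submatrix_mul_equiv]
  rw [h2, submatrix_id_mul_mul_conjTranspose, Equiv.prodCongr_symm, Equiv.symm_symm, Equiv.refl_symm,
    ← submatrix_windowSplit3_prodAssoc, hinner]
  simp only [Matrix.mul_assoc, Matrix.conjTranspose_mul]

/-- **Substitution identity, right** (KSDN eq. (TNrho5constraintsSUB), second row): for every `(k+2)`-window operator
`Y`, read in the coordinates (first site, last `k+1` sites),
`(𝟙 ⊗ W_{k+1}) Y (𝟙 ⊗ W_{k+1})ᴴ = (𝟙 ⊗ R) · C_k(Y) · (𝟙 ⊗ R)ᴴ`. [cite: KullEtAl2024, §2.4 eqs. (MPSrelation), (TNrho5constraintsSUB)] -/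
theorem one_kronecker_cgMap_succ_conj (A : Fin q → Matrix β β ℂ) (k : ℕ) (Y : Op (Fin (k + 2)) q) :
    ((1 : Matrix (Fin q) (Fin q) ℂ) ⊗ₖ cgMap A (k + 1)) *
        Y.submatrix (Fin.consEquiv fun _ => Fin q) (Fin.consEquiv fun _ => Fin q) *
      ((1 : Matrix (Fin q) (Fin q) ℂ) ⊗ₖ cgMap A (k + 1))ᴴ =
    ((1 : Matrix (Fin q) (Fin q) ℂ) ⊗ₖ rightMap A) * cgState A k Y * ((1 : Matrix (Fin q) (Fin q) ℂ) ⊗ₖ rightMap A)ᴴ := by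
  -- `W_{k+1} = (R (W_k ⊗ 𝟙)) ∘ snoc⁻¹`
  have h1 : cgMap A (k + 1) =
      (rightMap A * (cgMap A k ⊗ₖ (1 : Matrix (Fin q) (Fin q) ℂ))).submatrix id
        ((Equiv.prodComm _ _).trans (Fin.snocEquiv fun _ => Fin q)).symm := by
    rw [← cgMap_succ_submatrix_snocEquiv, Matrix.submatrix_submatrix, Function.comp_id, Equiv.self_comp_symm,
      Matrix.submatrix_id_id]
  have h2 : (1 : Matrix (Fin q) (Fin q) ℂ) ⊗ₖ cgMap A (k + 1) =
      ((((1 : Matrix (Fin q) (Fin q) ℂ) ⊗ₖ rightMap A)) *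
          ((1 : Matrix (Fin q) (Fin q) ℂ) ⊗ₖ (cgMap A k ⊗ₖ (1 : Matrix (Fin q) (Fin q) ℂ)))).submatrix id
        (Equiv.prodCongr (Equiv.refl (Fin q)) ((Equiv.prodComm _ _).trans (Fin.snocEquiv fun _ => Fin q)).symm) := by
    rw [h1, kronecker_submatrix_id, one_kronecker_mul]
  rw [h2, submatrix_id_mul_mul_conjTranspose, Equiv.prodCongr_symm, Equiv.symm_symm, Equiv.refl_symm,
    ← submatrix_windowSplit3_eq, cgState_eq]
  simp only [Matrix.mul_assoc, Matrix.conjTranspose_mul]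

/-! #### The rows `E_mL` / `E_mR`: tracing an edge site of `C_{k+1}(ρ)` lands on `C_k` of the marginal -/

/-- **Row `E_mL` on true marginals** (`m = k+3`): for every `(k+3)`-window operator `ρ`,
`tr_L C_{k+1}(ρ) = (L ⊗ 𝟙) · C_k(tr_L ρ) · (L ⊗ 𝟙)ᴴ` (the compressed variable reassociated to `(s_L,(a,b)) × s_R`).
With a consistent chain `tr_L ρ^{(m)} = ρ^{(m-1)}` this is the relaxation row
`(L ⊗ 𝟙) ω_{m-1} (L ⊗ 𝟙)ᴴ = tr_L ω_m`, `ω_m := C_{m-2}(ρ^{(m)})`, satisfied by the true marginals — the feasibility half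
of the relaxation for ANY tensor `A`. [cite: KullEtAl2024, §2.4 eq. (TNrho5constraintsSUB), §2.5 eq. (TNfullRelax5), §4.2 eq. (relaxLocTIn)] -/
theorem traceLeft_cgState_succ (A : Fin q → Matrix β β ℂ) (k : ℕ) (ρ : Op (Fin (k + 1 + 2)) q) :
    traceLeft (cgState A (k + 1) ρ) =
      (leftMap A ⊗ₖ (1 : Matrix (Fin q) (Fin q) ℂ)) *
        (cgState A k (spinPartialTrace (Fin.succEmb (k + 2)) ρ)).submatrix (Equiv.prodAssoc _ _ _) (Equiv.prodAssoc _ _ _) *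
      (leftMap A ⊗ₖ (1 : Matrix (Fin q) (Fin q) ℂ))ᴴ := by
  rw [traceLeft_cgState, cgMap_succ_kronecker_one_conj]

/-- **Row `E_mR` on true marginals** (`m = k+3`): for every `(k+3)`-window operator `ρ`,
`tr_R C_{k+1}(ρ) = (𝟙 ⊗ R) · C_k(tr_R ρ) · (𝟙 ⊗ R)ᴴ`. With a consistent chain `tr_R ρ^{(m)} = ρ^{(m-1)}` this is the
relaxation row `(𝟙 ⊗ R) ω_{m-1} (𝟙 ⊗ R)ᴴ = tr_R ω_m`. [cite: KullEtAl2024, §2.4 eq. (TNrho5constraintsSUB), §2.5 eq. (TNfullRelax5), §4.2 eq. (relaxLocTIn)] -/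
theorem traceRight_cgState_succ_submatrix_prodAssoc (A : Fin q → Matrix β β ℂ) (k : ℕ) (ρ : Op (Fin (k + 1 + 2)) q) :
    traceRight ((cgState A (k + 1) ρ).submatrix (Equiv.prodAssoc _ _ _) (Equiv.prodAssoc _ _ _)) =
      ((1 : Matrix (Fin q) (Fin q) ℂ) ⊗ₖ rightMap A) * cgState A k (spinPartialTrace Fin.castSuccEmb ρ) *
        ((1 : Matrix (Fin q) (Fin q) ℂ) ⊗ₖ rightMap A)ᴴ := by
  rw [traceRight_cgState_submatrix_prodAssoc, one_kronecker_cgMap_succ_conj]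

end Windows

end MPSCoarseGraining

end Literature.MathematicalPhysics.QuantumLattice
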